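import Summits.Ventures.YMGap.RobustBall.ThreePointDecayStar
import Summits.Ventures.YMGap.RobustBall.SecondSusceptibilityMajorantS
import HarnessLib

/-!
# Venture YMGap, track ROBUST-BALL (Y2) — THROUGH THE STAR DOOR: THE SECOND-ORDER STATIC SUSCEPTIBILITY OF EVERY LOCAL OBSERVABLE AGAINST TWO
# DIRECTIONS IS AN ABSOLUTELY CONVERGENT DOUBLE SERIES (the star twin of `SecondSusceptibilityMajorantS` + `SecondSusceptibilityS`;
# the `SU(2)` Wilson point for EVERY `0 ≤ β_W ≤ 1/3`)

HONEST FRAMING. WHAT THIS IS: a venture file (cell `pub-ymgap`, track Y2 ROBUST-BALL, seat rb-p1, theorems only).  Setting of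
`ThreePointDecayStar`: a specification `γ` on `ℤ^d` with quasilocal vertex-star kernels of radius `D ≥ 1`, a star window bound with received sum
`0 ≤ ρ < 1`, ANY Gibbs measure `μ` of `γ`; `ρ' := max(ρ, ½)`, `t := log(1/ρ')/(D+2)`, `s := t/3`; local observable `F` (on `Λ_F`, Frobenius-Lipschitz
vector `δ_F`, bounded); directions `V`, `V'` with measurable bounded own-link terms and Frobenius-Lipschitz witnesses of total loads `≤ L`, `≤ L'`
and SIZE-WEIGHTED loads `Σ'_{X∋e} #X·Σ_y lipV_X(y) ≤ L₂`, `≤ L₂'` through every link; `u₃(F; V_X; V'_Y) := cov(F V_X, V'_Y) − ⟨F⟩cov(V_X, V'_Y) − ⟨V_X⟩cov(F, V'_Y)`: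
* `abs_threePoint_le_majorant_star` — the termwise majorant (bookkeeping form of `SecondSusceptibilityMajorantS.abs_threePoint_le_majorant_S` with
  `Σδ_F` replaced by `ρ'⁻¹ Σδ_F` and the pair-door rate by the star rate): `|u₃(F; V_X; V'_Y)| ≤ 768 N√N (ρ'⁻¹Σδ_F) L_X L'_Y (G_F(X)G_F(Y) + G_F(X)G_X(Y) + G_F(Y)G_Y(X))`;
* ★★ `sum_abs_threePoint_le_star` / `summable_abs_threePoint_direction_star` — for all finite families `T`, `T'`, and summed over ALL pairs:
  `Σ |u₃(F; V_X; V'_Y)| ≤ 768 N√N (ρ'⁻¹Σδ_F)(#Λ_F C_s)(L L' #Λ_F C_s + L' L₂ C_s + L L₂' C_s)`, `C_s = d((1+e^{−s/d})/(1−e^{−s/d}))^d` — ONE constant for every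
  specification with the same star data and every Gibbs measure (the load bookkeeping `sum_majorant_le_S` is door-independent);
* ★ `su2_wilson_summable_abs_threePoint_upTo_oneThird` — `SU(2)`, `ℤ⁴`, THE WILSON POINT FOR EVERY `0 ≤ β_W ≤ 1/3` (received sum `≤ 399/400`, `D = 3`):
  for every DLR state, every Lipschitz cylinder `F` and every two directions of finite total and size-weighted Lipschitz loads, the second-order
  susceptibility `Σ_{(X,Y)} u₃(F; V_X; V'_Y)` is an absolutely convergent double series — in particular (with `V = V' =` the Wilson direction) THE
  SECOND β-DERIVATIVE COEFFICIENT OF EVERY WILSON LOOP IS A CONVERGENT DOUBLE PLAQUETTE SUM ON THE WHOLE SEGMENT (identification: successor file).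
WHAT THIS IS NOT: the identification of the double series with a second derivative (needs Feynman–Hellmann along truncated lines through the star
door — `StateSecondDerivativeStar`); one-sided comparison constants; lattice strong coupling only; nothing continuum / Clay-sense mass gap.
-/

noncomputable section

open MeasureTheory Function Finset ProbabilityTheory Real
open scoped NNReal
open Literature.Probability.LatticeModels
open Literature.Probability.LatticeModels.DobrushinMetric
open Literature.MathematicalPhysics.QuantumLattice
open Literature.MathematicalPhysics.QuantumFieldTheory hiding ZdEdge
open Literature.MathematicalPhysics.QuantumFieldTheory.Balaban1983to89.StrongCouplingDobrushinWindow (OneLinkKRModulus)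
open Summit.Ventures.YMGap.CouplingResponse (threePoint_swap threePoint_rotate)
open Summit.Ventures.YMGap.DSWindowZd
open Summit.Ventures.YMGap.StarResolventDim (gaugeR doorPoly Delta)

namespace Summit.Ventures.YMGap.RobustBall

variable {d N : ℕ}

/-! ### The termwise majorant through the star door -/

section Star

variable {γ : Specification (ZdEdge d) (SUN N)} {D : ℕ} {ρ : ℝ} {μ : Measure (LGConfig d (SUN N))}
  {V V' : Potential (ZdEdge d) (SUN N)}

/-- **Termwise majorant of the third cumulant against two directions, through the star door (bookkeeping form).**  Specification `γ` with
quasilocal star kernels of radius `D ≥ 1`, star window bound with received sum `0 ≤ ρ < 1`, Gibbs measure `μ`; `t = log(1/max(ρ,½))/(D+2)`; `F`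
local (on `Λ_F`, vector `δ_F`, bounded); directions `V`, `V'` with measurable bounded own-link terms and Frobenius-Lipschitz witnesses `lipV`,
`lipV'`.  With the abbreviations `s = t/3`, `S_f = max(ρ,½)⁻¹ Σδ_F`, `L_X = Σ_y lipV_X(y)`, `L'_Y`, `g_Δ(e) = e^{−s·dist(e,Δ)}` (passed as equations), for
all `X`, `Y`: `|u₃(F; V_X; V'_Y)| ≤ 768 N√N S_f · L_X L'_Y · (G_F(X)G_F(Y) + G_F(X)G_X(Y) + G_F(Y)G_Y(X))`, `G_Δ(Z) = Σ_{e∈Z} g_Δ(e)`. -/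
theorem abs_threePoint_le_majorant_star (hd : 1 ≤ d) (hγ : IsSpecification γ) (hD : 1 ≤ D)
    (hloc : ∀ (c : ZdEdge d) (ζ ζ' : LGConfig d (SUN N)), (∀ v ∈ starNbhdZdR D c.1, ζ v = ζ' v) →
      ∀ (f : LGConfig d (SUN N) → ℝ), Measurable f → (∃ B, ∀ σ, |f σ| ≤ B) →
        DependsOn f (starWinZd c : Set (ZdEdge d)) →
        ∫ σ, f σ ∂(γ (starWinZd c) ζ) = ∫ σ, f σ ∂(γ (starWinZd c) ζ'))
    (hρ0 : 0 ≤ ρ) (hρ1 : ρ < 1) (hwin : StarWindowBoundZdR d N γ D ρ suFrobDist) (hμ : IsGibbsMeasure γ μ)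
    {t : ℝ} (ht : t = -Real.log (max ρ (1 / 2)) / (D + 2 : ℕ))
    {F : LGConfig d (SUN N) → ℝ} (hFm : Measurable F) {ΛF : Finset (ZdEdge d)}
    (hFdep : DependsOn F (↑ΛF : Set (ZdEdge d))) {MF : ℝ} (hMF : ∀ σ, |F σ| ≤ MF) {δF : ZdEdge d → ℝ} (hδF : IsLipBound suFrobDist F δF)
    (hVm : ∀ X, Measurable (V X)) (hVdep : ∀ X, DependsOn (V X) (↑X : Set (ZdEdge d))) (hVb : ∀ X, ∃ C, ∀ U, |V X U| ≤ C)
    {lipV : Finset (ZdEdge d) → ZdEdge d → ℝ} (hlipV : ∀ X, IsLipBound suFrobDist (V X) (lipV X))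
    (hV'm : ∀ X, Measurable (V' X)) (hV'dep : ∀ X, DependsOn (V' X) (↑X : Set (ZdEdge d))) (hV'b : ∀ X, ∃ C, ∀ U, |V' X U| ≤ C)
    {lipV' : Finset (ZdEdge d) → ZdEdge d → ℝ} (hlipV' : ∀ X, IsLipBound suFrobDist (V' X) (lipV' X))
    {s : ℝ} (hs : s = t / 3) {Sf : ℝ} (hSf : Sf = (max ρ (1 / 2))⁻¹ * ∑ y ∈ ΛF, δF y)
    {LX LY : Finset (ZdEdge d) → ℝ} (hLX : LX = fun X => ∑ y ∈ X, lipV X y) (hLY : LY = fun Y => ∑ y ∈ Y, lipV' Y y)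
    {gD : Finset (ZdEdge d) → ZdEdge d → ℝ} (hgD : gD = fun Δ e => exp (-s * linkSetDist Δ e)) (X Y : Finset (ZdEdge d)) :
    |cov[fun σ => F σ * V X σ, V' Y; μ] - (∫ σ, F σ ∂μ) * cov[V X, V' Y; μ] - (∫ σ, V X σ ∂μ) * cov[F, V' Y; μ]| ≤
      768 * N * Real.sqrt N * Sf * (LX X * LY Y * ((∑ e ∈ X, gD ΛF e) * (∑ e ∈ Y, gD ΛF e) +
        (∑ e ∈ X, gD ΛF e) * (∑ e ∈ Y, gD X e) + (∑ e ∈ Y, gD ΛF e) * (∑ e ∈ X, gD Y e))) := by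
  classical
  haveI := hμ.isProbabilityMeasure
  have hρ'0 : 0 < max ρ (1 / 2) := lt_of_lt_of_le (by norm_num) (le_max_right _ _)
  have hρ'1 : max ρ (1 / 2) < 1 := max_lt hρ1 (by norm_num)
  have hlogneg : 0 < -Real.log (max ρ (1 / 2)) := by have := Real.log_neg hρ'0 hρ'1; linarith
  have htpos : 0 < t := by rw [ht]; exact div_pos hlogneg (by positivity)
  have hδ0 : 0 ≤ ∑ y ∈ ΛF, δF y := sum_nonneg fun y _ => hδF.nonneg y
  have hSf0 : 0 ≤ Sf := by rw [hSf]; exact mul_nonneg (inv_pos.2 hρ'0).le hδ0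
  have hLX0 : ∀ X, 0 ≤ LX X := fun X => by rw [hLX]; exact sum_nonneg fun y _ => (hlipV X).nonneg y
  have hLY0 : ∀ Y, 0 ≤ LY Y := fun Y => by rw [hLY]; exact sum_nonneg fun y _ => (hlipV' Y).nonneg y
  have hgD0 : ∀ Δ e, 0 ≤ gD Δ e := fun Δ e => by rw [hgD]; exact (exp_pos _).le
  have hd0 : 0 < d := hd
  have hNN : (0 : ℝ) ≤ N := Nat.cast_nonneg N
  have hs0 : 0 < s := by rw [hs]; positivity
  -- conversion of a set distance into a link sum
  have hconv : ∀ {A X : Finset (ZdEdge d)}, A.Nonempty → X.Nonempty → exp (-(s * setDistEdges A X)) ≤ ∑ e ∈ X, gD A e := by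
    intro A X hA hX
    obtain ⟨u, hu, w, hw, heq⟩ := exists_setDistEdges_eq hA hX
    have h1 : linkSetDist A w ≤ ‖u.1 - w.1‖ := by
      unfold linkSetDist; rw [dif_pos hA, norm_sub_rev]; exact Finset.inf'_le _ hu
    rw [hgD]
    calc exp (-(s * setDistEdges A X)) ≤ exp (-s * linkSetDist A w) := exp_le_exp.2 (by rw [heq]; nlinarith)
      _ ≤ ∑ e ∈ X, exp (-s * linkSetDist A e) := single_le_sum (f := fun e => exp (-s * linkSetDist A e)) (fun e _ => (exp_pos _).le) hw
  have hexp1 : ∀ A X : Finset (ZdEdge d), exp (-(s * setDistEdges A X)) ≤ 1 :=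
    fun A X => exp_le_one_iff.2 (by nlinarith [setDistEdges_nonneg A X])
  -- centred observables
  have hN2 : (0 : ℝ) ≤ 2 * Real.sqrt N := by positivity
  have hcentre : ∀ {h : LGConfig d (SUN N) → ℝ} {Δ : Finset (ZdEdge d)} {δ : ZdEdge d → ℝ},
      DependsOn h (↑Δ : Set (ZdEdge d)) → IsLipBound suFrobDist h δ →
      (DependsOn (fun σ => h σ - h 1) (↑Δ : Set (ZdEdge d))) ∧ IsLipBound suFrobDist (fun σ => h σ - h 1) δ ∧
        ∀ σ, |h σ - h 1| ≤ 2 * Real.sqrt N * ∑ y ∈ Δ, δ y := by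
    intro h Δ δ hdep hδ
    refine ⟨fun σ τ hστ => by simp only [hdep hστ], ⟨hδ.nonneg, fun y σ τ hστ => by
      simpa only [sub_sub_sub_cancel_right] using hδ.le y σ τ hστ⟩, fun σ => ?_⟩
    calc |h σ - h 1| ≤ ∑ y ∈ Δ, δ y * suFrobDist (σ y) ((1 : LGConfig d (SUN N)) y) :=
          abs_sub_le_sum_of_dependsOn hdep hδ σ 1
      _ ≤ ∑ y ∈ Δ, δ y * (2 * Real.sqrt N) := sum_le_sum fun y _ => mul_le_mul_of_nonneg_left (suFrobDist_le _ _) (hδ.nonneg y)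
      _ = 2 * Real.sqrt N * ∑ y ∈ Δ, δ y := by rw [← sum_mul]; ring
  obtain ⟨hF₁dep, hF₁lip, hF₁b⟩ := hcentre hFdep hδF
  obtain ⟨Sf₀, hSf₀⟩ : ∃ x : ℝ, x = ∑ y ∈ ΛF, δF y := ⟨_, rfl⟩
  -- the per-term tree bound for the centred observables
  have hterm : ∀ X Y, |cov[fun σ => F σ * V X σ, V' Y; μ] - (∫ σ, F σ ∂μ) * cov[V X, V' Y; μ] - (∫ σ, V X σ ∂μ) * cov[F, V' Y; μ]| ≤
      192 * N * Real.sqrt N * Sf * LX X * LY Y *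
        ((exp (-(s * setDistEdges ΛF Y)) + exp (-(s * setDistEdges X Y))) *
          (exp (-(s * setDistEdges ΛF X)) + exp (-(s * setDistEdges Y X))) *
          (exp (-(s * setDistEdges X ΛF)) + exp (-(s * setDistEdges Y ΛF)))) := by
    intro X Y
    obtain ⟨hXdep, hXlip, hXb⟩ := hcentre (hVdep X) (hlipV X)
    obtain ⟨hYdep, hYlip, hYb⟩ := hcentre (hV'dep Y) (hlipV' Y)
    obtain ⟨CX, hCX⟩ := hVb X
    obtain ⟨CY, hCY⟩ := hV'b Y
    have hXm : Measurable fun σ => V X σ - V X 1 := (hVm X).sub measurable_const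
    have hYm : Measurable fun σ => V' Y σ - V' Y 1 := (hV'm Y).sub measurable_const
    -- centring: `u₃(F; V_X; V'_Y) = u₃(F − F(1); V_X − V_X(1); V'_Y − V'_Y(1))` (rotate / centre the last slot, three times)
    have hFcm : Measurable (fun σ => F σ - F 1) := hFm.sub measurable_const
    have hCX' : ∀ σ, |V X σ - V X 1| ≤ CX + CX := fun σ => (abs_sub _ _).trans (add_le_add (hCX σ) (hCX 1))
    have hCY' : ∀ σ, |V' Y σ - V' Y 1| ≤ CY + CY := fun σ => (abs_sub _ _).trans (add_le_add (hCY σ) (hCY 1))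
    have hMF' : ∀ σ, |F σ - F 1| ≤ MF + MF := fun σ => (abs_sub _ _).trans (add_le_add (hMF σ) (hMF 1))
    have e0 : cov[fun σ => F σ * V X σ, V' Y; μ] - (∫ σ, F σ ∂μ) * cov[V X, V' Y; μ] - (∫ σ, V X σ ∂μ) * cov[F, V' Y; μ] =
        cov[fun σ => (F σ - F 1) * (V X σ - V X 1), fun σ => V' Y σ - V' Y 1; μ] -
          (∫ σ, (F σ - F 1) ∂μ) * cov[fun σ => V X σ - V X 1, fun σ => V' Y σ - V' Y 1; μ] -
          (∫ σ, (V X σ - V X 1) ∂μ) * cov[fun σ => F σ - F 1, fun σ => V' Y σ - V' Y 1; μ] :=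
      calc cov[fun σ => F σ * V X σ, V' Y; μ] - (∫ σ, F σ ∂μ) * cov[V X, V' Y; μ] - (∫ σ, V X σ ∂μ) * cov[F, V' Y; μ]
          = cov[fun σ => V X σ * V' Y σ, F; μ] - (∫ σ, V X σ ∂μ) * cov[V' Y, F; μ] - (∫ σ, V' Y σ ∂μ) * cov[V X, F; μ] :=
            threePoint_rotate hFm (hVm X) (hV'm Y) hMF hCX hCY
        _ = cov[fun σ => V X σ * V' Y σ, fun σ => F σ - F 1; μ] - (∫ σ, V X σ ∂μ) * cov[V' Y, fun σ => F σ - F 1; μ] -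
              (∫ σ, V' Y σ ∂μ) * cov[V X, fun σ => F σ - F 1; μ] :=
            (threePoint_sub_const_right (hVm X) (hV'm Y) hFm hCX hCY hMF (F 1)).symm
        _ = cov[fun σ => V' Y σ * (F σ - F 1), V X; μ] - (∫ σ, V' Y σ ∂μ) * cov[fun σ => F σ - F 1, V X; μ] -
              (∫ σ, (F σ - F 1) ∂μ) * cov[V' Y, V X; μ] :=
            threePoint_rotate (hVm X) (hV'm Y) hFcm hCX hCY hMF'
        _ = cov[fun σ => V' Y σ * (F σ - F 1), fun σ => V X σ - V X 1; μ] -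
              (∫ σ, V' Y σ ∂μ) * cov[fun σ => F σ - F 1, fun σ => V X σ - V X 1; μ] -
              (∫ σ, (F σ - F 1) ∂μ) * cov[V' Y, fun σ => V X σ - V X 1; μ] :=
            (threePoint_sub_const_right (hV'm Y) hFcm (hVm X) hCY hMF' hCX (V X 1)).symm
        _ = cov[fun σ => (F σ - F 1) * (V X σ - V X 1), V' Y; μ] - (∫ σ, (F σ - F 1) ∂μ) * cov[fun σ => V X σ - V X 1, V' Y; μ] -
              (∫ σ, (V X σ - V X 1) ∂μ) * cov[fun σ => F σ - F 1, V' Y; μ] :=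
            threePoint_rotate (hV'm Y) hFcm hXm hCY hMF' hCX'
        _ = _ := (threePoint_sub_const_right hFcm hXm (hV'm Y) hMF' hCX' hCY (V' Y 1)).symm
    rw [e0]
    have h1 := abs_threePoint_le_tree_star hγ hD hloc hρ0 hρ1 hwin hμ ht hFcm hF₁dep hF₁b hF₁lip hXm hXdep hXb hXlip hYm hYdep hYb hYlip
    rw [← hSf₀, show (∑ y ∈ X, lipV X y) = LX X by rw [hLX], show (∑ y ∈ Y, lipV' Y y) = LY Y by rw [hLY]] at h1
    refine h1.trans (le_of_eq ?_)
    rw [← hs]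
    have : 16 * (N : ℝ) * (max ρ (1 / 2))⁻¹ * ((2 * Real.sqrt N * Sf₀ * LX X + 2 * Real.sqrt N * LX X * Sf₀) * LY Y +
        (2 * Real.sqrt N * Sf₀ * LY Y + 2 * Real.sqrt N * LY Y * Sf₀) * LX X +
        (2 * Real.sqrt N * LX X * LY Y + 2 * Real.sqrt N * LY Y * LX X) * Sf₀) = 192 * N * Real.sqrt N * Sf * LX X * LY Y := by
      rw [hSf, ← hSf₀]; ring
    rw [this]
  -- trees: the three-bracket product is at most four trees, each dominated by link sums
  have htree : ∀ X Y, X.Nonempty → Y.Nonempty → ΛF.Nonempty →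
      (exp (-(s * setDistEdges ΛF Y)) + exp (-(s * setDistEdges X Y))) *
          (exp (-(s * setDistEdges ΛF X)) + exp (-(s * setDistEdges Y X))) *
          (exp (-(s * setDistEdges X ΛF)) + exp (-(s * setDistEdges Y ΛF))) ≤
        4 * ((∑ e ∈ X, gD ΛF e) * (∑ e ∈ Y, gD ΛF e) + (∑ e ∈ X, gD ΛF e) * (∑ e ∈ Y, gD X e) +
          (∑ e ∈ Y, gD ΛF e) * (∑ e ∈ X, gD Y e)) := by
    intro X Y hX hY hΛ
    -- symmetric distances
    have hsym : ∀ A B : Finset (ZdEdge d), setDistEdges A B = setDistEdges B A := fun A B => by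
      by_cases hA : A.Nonempty
      · by_cases hB : B.Nonempty
        · apply le_antisymm
          · obtain ⟨u, hu, w, hw, heq⟩ := exists_setDistEdges_eq hB hA
            rw [heq, norm_sub_rev]; exact setDistEdges_le_norm_sub hw hu
          · obtain ⟨u, hu, w, hw, heq⟩ := exists_setDistEdges_eq hA hB
            rw [heq, norm_sub_rev]; exact setDistEdges_le_norm_sub hw hu
        · rw [setDistEdges_of_not_nonempty hB, setDistEdges]; rw [dif_neg]; exact fun ⟨p, hp⟩ => hB ⟨p.1, (Finset.mem_product.1 hp).1⟩
      · rw [setDistEdges_of_not_nonempty hA, setDistEdges]; rw [dif_neg]; exact fun ⟨p, hp⟩ => hA ⟨p.1, (Finset.mem_product.1 hp).1⟩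
    rw [hsym Y X, hsym X ΛF, hsym Y ΛF]
    obtain ⟨p, hp⟩ : ∃ x : ℝ, x = exp (-(s * setDistEdges ΛF X)) := ⟨_, rfl⟩
    obtain ⟨q, hq⟩ : ∃ x : ℝ, x = exp (-(s * setDistEdges ΛF Y)) := ⟨_, rfl⟩
    obtain ⟨r, hr⟩ : ∃ x : ℝ, x = exp (-(s * setDistEdges X Y)) := ⟨_, rfl⟩
    rw [← hp, ← hq, ← hr]
    have hp0 : 0 ≤ p := by rw [hp]; exact (exp_pos _).le
    have hq0 : 0 ≤ q := by rw [hq]; exact (exp_pos _).le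
    have hr0 : 0 ≤ r := by rw [hr]; exact (exp_pos _).le
    have hb := brackets_le_four_trees hp0 (hp ▸ hexp1 ΛF X) hq0 (hq ▸ hexp1 ΛF Y) hr0 (hr ▸ hexp1 X Y)
    have cp : p ≤ ∑ e ∈ X, gD ΛF e := hp ▸ hconv hΛ hX
    have cq : q ≤ ∑ e ∈ Y, gD ΛF e := hq ▸ hconv hΛ hY
    have cr : r ≤ ∑ e ∈ Y, gD X e := hr ▸ hconv hX hY
    have cr' : r ≤ ∑ e ∈ X, gD Y e := by rw [hr, hsym X Y]; exact hconv hY hX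
    have gX0 : 0 ≤ ∑ e ∈ X, gD ΛF e := sum_nonneg fun e _ => hgD0 _ _
    have gY0 : 0 ≤ ∑ e ∈ Y, gD ΛF e := sum_nonneg fun e _ => hgD0 _ _
    calc (q + r) * (p + r) * (p + q) ≤ 4 * (p * q + p * r + q * r) := hb
      _ ≤ 4 * ((∑ e ∈ X, gD ΛF e) * (∑ e ∈ Y, gD ΛF e) + (∑ e ∈ X, gD ΛF e) * (∑ e ∈ Y, gD X e) +
          (∑ e ∈ Y, gD ΛF e) * (∑ e ∈ X, gD Y e)) := by
        gcongr
  -- assemble the termwise bound (empty `Λ_F`, `X` or `Y` contribute `0`)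
  refine (hterm X Y).trans ?_
  by_cases hΛF : ΛF.Nonempty
  swap
  · have hS0 : Sf = 0 := by rw [hSf, Finset.not_nonempty_iff_eq_empty.1 hΛF, sum_empty, mul_zero]
    rw [hS0]; simp
  by_cases hX : X.Nonempty
  · by_cases hY : Y.Nonempty
    · have h := htree X Y hX hY hΛF
      have hK : 0 ≤ 192 * N * Real.sqrt N * Sf * LX X * LY Y := by
        have := hLX0 X; have := hLY0 Y; positivity
      calc 192 * N * Real.sqrt N * Sf * LX X * LY Y * _ ≤ 192 * N * Real.sqrt N * Sf * LX X * LY Y * _ := mul_le_mul_of_nonneg_left h hK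
        _ = _ := by ring
    · have hY0 : LY Y = 0 := by rw [hLY]; simp [Finset.not_nonempty_iff_eq_empty.1 hY]
      rw [hY0]; simp
  · have hX0 : LX X = 0 := by rw [hLX]; simp [Finset.not_nonempty_iff_eq_empty.1 hX]
    rw [hX0]; simp

/-- ★★ **PARTIAL SUMS OF THE SECOND-ORDER SUSCEPTIBILITY THROUGH THE STAR DOOR.**  Under the hypotheses of `abs_threePoint_le_majorant_star`, with
Frobenius-Lipschitz witnesses of total loads `≤ L`, `≤ L'` and size-weighted loads `≤ L₂`, `≤ L₂'` through every link, for all finite families `T`, `T'`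
of link sets: `Σ_{X∈T} Σ_{Y∈T'} |u₃(F; V_X; V'_Y)| ≤ 768 N√N (Σ_y ρ'⁻¹δ_F(y))(#Λ_F C_s)(L L' #Λ_F C_s + L' L₂ C_s + L L₂' C_s)`,
`C_s = d((1+e^{−(t/3)/d})/(1−e^{−(t/3)/d}))^d`. -/
theorem sum_abs_threePoint_le_star (hd : 1 ≤ d) (hγ : IsSpecification γ) (hD : 1 ≤ D)
    (hloc : ∀ (c : ZdEdge d) (ζ ζ' : LGConfig d (SUN N)), (∀ v ∈ starNbhdZdR D c.1, ζ v = ζ' v) →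
      ∀ (f : LGConfig d (SUN N) → ℝ), Measurable f → (∃ B, ∀ σ, |f σ| ≤ B) →
        DependsOn f (starWinZd c : Set (ZdEdge d)) →
        ∫ σ, f σ ∂(γ (starWinZd c) ζ) = ∫ σ, f σ ∂(γ (starWinZd c) ζ'))
    (hρ0 : 0 ≤ ρ) (hρ1 : ρ < 1) (hwin : StarWindowBoundZdR d N γ D ρ suFrobDist) (hμ : IsGibbsMeasure γ μ)
    {t : ℝ} (ht : t = -Real.log (max ρ (1 / 2)) / (D + 2 : ℕ))
    {F : LGConfig d (SUN N) → ℝ} (hFm : Measurable F) {ΛF : Finset (ZdEdge d)}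
    (hFdep : DependsOn F (↑ΛF : Set (ZdEdge d))) {MF : ℝ} (hMF : ∀ σ, |F σ| ≤ MF) {δF : ZdEdge d → ℝ} (hδF : IsLipBound suFrobDist F δF)
    (hVm : ∀ X, Measurable (V X)) (hVdep : ∀ X, DependsOn (V X) (↑X : Set (ZdEdge d))) (hVb : ∀ X, ∃ C, ∀ U, |V X U| ≤ C)
    {lipV : Finset (ZdEdge d) → ZdEdge d → ℝ} (hlipV : ∀ X, IsLipBound suFrobDist (V X) (lipV X)) {L L₂ : ℝ}
    (hLs : ∀ e, Summable fun X : Finset (ZdEdge d) => (if e ∈ X then ∑ y ∈ X, lipV X y else 0))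
    (hL : ∀ e, ∑' X : Finset (ZdEdge d), (if e ∈ X then ∑ y ∈ X, lipV X y else 0) ≤ L)
    (hL2s : ∀ e, Summable fun X : Finset (ZdEdge d) => (if e ∈ X then X.card * ∑ y ∈ X, lipV X y else 0))
    (hL2 : ∀ e, ∑' X : Finset (ZdEdge d), (if e ∈ X then X.card * ∑ y ∈ X, lipV X y else 0) ≤ L₂)
    (hV'm : ∀ X, Measurable (V' X)) (hV'dep : ∀ X, DependsOn (V' X) (↑X : Set (ZdEdge d))) (hV'b : ∀ X, ∃ C, ∀ U, |V' X U| ≤ C)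
    {lipV' : Finset (ZdEdge d) → ZdEdge d → ℝ} (hlipV' : ∀ X, IsLipBound suFrobDist (V' X) (lipV' X)) {L' L₂' : ℝ}
    (hL's : ∀ e, Summable fun X : Finset (ZdEdge d) => (if e ∈ X then ∑ y ∈ X, lipV' X y else 0))
    (hL' : ∀ e, ∑' X : Finset (ZdEdge d), (if e ∈ X then ∑ y ∈ X, lipV' X y else 0) ≤ L')
    (hL2's : ∀ e, Summable fun X : Finset (ZdEdge d) => (if e ∈ X then X.card * ∑ y ∈ X, lipV' X y else 0))
    (hL2' : ∀ e, ∑' X : Finset (ZdEdge d), (if e ∈ X then X.card * ∑ y ∈ X, lipV' X y else 0) ≤ L₂')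
    (T T' : Finset (Finset (ZdEdge d))) :
    ∑ X ∈ T, ∑ Y ∈ T', |cov[fun σ => F σ * V X σ, V' Y; μ] - (∫ σ, F σ ∂μ) * cov[V X, V' Y; μ] - (∫ σ, V X σ ∂μ) * cov[F, V' Y; μ]| ≤
      768 * N * Real.sqrt N * (∑ y ∈ ΛF, (max ρ (1 / 2))⁻¹ * δF y) *
        (ΛF.card * (d * ((1 + exp (-(t / 3 / d))) / (1 - exp (-(t / 3 / d)))) ^ d)) *
        (L * L' * (ΛF.card * (d * ((1 + exp (-(t / 3 / d))) / (1 - exp (-(t / 3 / d)))) ^ d)) +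
          L' * L₂ * (d * ((1 + exp (-(t / 3 / d))) / (1 - exp (-(t / 3 / d)))) ^ d) +
          L * L₂' * (d * ((1 + exp (-(t / 3 / d))) / (1 - exp (-(t / 3 / d)))) ^ d)) := by
  classical
  have hρ'0 : 0 < max ρ (1 / 2) := lt_of_lt_of_le (by norm_num) (le_max_right _ _)
  have hρ'1 : max ρ (1 / 2) < 1 := max_lt hρ1 (by norm_num)
  have hlogneg : 0 < -Real.log (max ρ (1 / 2)) := by have := Real.log_neg hρ'0 hρ'1; linarith
  have htpos : 0 < t := by rw [ht]; exact div_pos hlogneg (by positivity)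
  have hSf : (∑ y ∈ ΛF, (max ρ (1 / 2))⁻¹ * δF y) = (max ρ (1 / 2))⁻¹ * ∑ y ∈ ΛF, δF y := by rw [mul_sum]
  have hterm := fun X Y => abs_threePoint_le_majorant_star hd hγ hD hloc hρ0 hρ1 hwin hμ ht hFm hFdep hMF hδF hVm hVdep hVb hlipV hV'm hV'dep
    hV'b hlipV' rfl hSf rfl rfl rfl X Y
  have hsum := sum_majorant_le_S (N := N) (ΛF := ΛF) hd htpos (δF := fun y => (max ρ (1 / 2))⁻¹ * δF y)
    (fun y => mul_nonneg (inv_pos.2 hρ'0).le (hδF.nonneg y)) hlipV hLs hL hL2s hL2 hlipV' hL's hL' hL2's hL2' rfl rfl rfl rfl rfl rfl T T'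
  exact (sum_le_sum fun X _ => sum_le_sum fun Y _ => hterm X Y).trans hsum

/-- ★★ **THE SECOND-ORDER SUSCEPTIBILITY IS AN ABSOLUTELY CONVERGENT DOUBLE SERIES, THROUGH THE STAR DOOR.**  Under the hypotheses of
`sum_abs_threePoint_le_star`, `(X, Y) ↦ |u₃(F; V_X; V'_Y)|` is summable over ALL pairs of finite link sets, with the same bound on its sum. -/
theorem summable_abs_threePoint_direction_star (hd : 1 ≤ d) (hγ : IsSpecification γ) (hD : 1 ≤ D)
    (hloc : ∀ (c : ZdEdge d) (ζ ζ' : LGConfig d (SUN N)), (∀ v ∈ starNbhdZdR D c.1, ζ v = ζ' v) →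
      ∀ (f : LGConfig d (SUN N) → ℝ), Measurable f → (∃ B, ∀ σ, |f σ| ≤ B) →
        DependsOn f (starWinZd c : Set (ZdEdge d)) →
        ∫ σ, f σ ∂(γ (starWinZd c) ζ) = ∫ σ, f σ ∂(γ (starWinZd c) ζ'))
    (hρ0 : 0 ≤ ρ) (hρ1 : ρ < 1) (hwin : StarWindowBoundZdR d N γ D ρ suFrobDist) (hμ : IsGibbsMeasure γ μ)
    {t : ℝ} (ht : t = -Real.log (max ρ (1 / 2)) / (D + 2 : ℕ))
    {F : LGConfig d (SUN N) → ℝ} (hFm : Measurable F) {ΛF : Finset (ZdEdge d)}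
    (hFdep : DependsOn F (↑ΛF : Set (ZdEdge d))) {MF : ℝ} (hMF : ∀ σ, |F σ| ≤ MF) {δF : ZdEdge d → ℝ} (hδF : IsLipBound suFrobDist F δF)
    (hVm : ∀ X, Measurable (V X)) (hVdep : ∀ X, DependsOn (V X) (↑X : Set (ZdEdge d))) (hVb : ∀ X, ∃ C, ∀ U, |V X U| ≤ C)
    {lipV : Finset (ZdEdge d) → ZdEdge d → ℝ} (hlipV : ∀ X, IsLipBound suFrobDist (V X) (lipV X)) {L L₂ : ℝ}
    (hLs : ∀ e, Summable fun X : Finset (ZdEdge d) => (if e ∈ X then ∑ y ∈ X, lipV X y else 0))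
    (hL : ∀ e, ∑' X : Finset (ZdEdge d), (if e ∈ X then ∑ y ∈ X, lipV X y else 0) ≤ L)
    (hL2s : ∀ e, Summable fun X : Finset (ZdEdge d) => (if e ∈ X then X.card * ∑ y ∈ X, lipV X y else 0))
    (hL2 : ∀ e, ∑' X : Finset (ZdEdge d), (if e ∈ X then X.card * ∑ y ∈ X, lipV X y else 0) ≤ L₂)
    (hV'm : ∀ X, Measurable (V' X)) (hV'dep : ∀ X, DependsOn (V' X) (↑X : Set (ZdEdge d))) (hV'b : ∀ X, ∃ C, ∀ U, |V' X U| ≤ C)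
    {lipV' : Finset (ZdEdge d) → ZdEdge d → ℝ} (hlipV' : ∀ X, IsLipBound suFrobDist (V' X) (lipV' X)) {L' L₂' : ℝ}
    (hL's : ∀ e, Summable fun X : Finset (ZdEdge d) => (if e ∈ X then ∑ y ∈ X, lipV' X y else 0))
    (hL' : ∀ e, ∑' X : Finset (ZdEdge d), (if e ∈ X then ∑ y ∈ X, lipV' X y else 0) ≤ L')
    (hL2's : ∀ e, Summable fun X : Finset (ZdEdge d) => (if e ∈ X then X.card * ∑ y ∈ X, lipV' X y else 0))
    (hL2' : ∀ e, ∑' X : Finset (ZdEdge d), (if e ∈ X then X.card * ∑ y ∈ X, lipV' X y else 0) ≤ L₂') :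
    Summable (fun p : Finset (ZdEdge d) × Finset (ZdEdge d) =>
        |cov[fun σ => F σ * V p.1 σ, V' p.2; μ] - (∫ σ, F σ ∂μ) * cov[V p.1, V' p.2; μ] - (∫ σ, V p.1 σ ∂μ) * cov[F, V' p.2; μ]|) ∧
      ∑' p : Finset (ZdEdge d) × Finset (ZdEdge d),
          |cov[fun σ => F σ * V p.1 σ, V' p.2; μ] - (∫ σ, F σ ∂μ) * cov[V p.1, V' p.2; μ] - (∫ σ, V p.1 σ ∂μ) * cov[F, V' p.2; μ]| ≤
        768 * N * Real.sqrt N * (∑ y ∈ ΛF, (max ρ (1 / 2))⁻¹ * δF y) *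
          (ΛF.card * (d * ((1 + exp (-(t / 3 / d))) / (1 - exp (-(t / 3 / d)))) ^ d)) *
          (L * L' * (ΛF.card * (d * ((1 + exp (-(t / 3 / d))) / (1 - exp (-(t / 3 / d)))) ^ d)) +
            L' * L₂ * (d * ((1 + exp (-(t / 3 / d))) / (1 - exp (-(t / 3 / d)))) ^ d) +
            L * L₂' * (d * ((1 + exp (-(t / 3 / d))) / (1 - exp (-(t / 3 / d)))) ^ d)) := by
  classical
  -- every finite set of pairs sits inside a product of its projections
  have hpartial : ∀ S : Finset (Finset (ZdEdge d) × Finset (ZdEdge d)), ∑ p ∈ S,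
      |cov[fun σ => F σ * V p.1 σ, V' p.2; μ] - (∫ σ, F σ ∂μ) * cov[V p.1, V' p.2; μ] - (∫ σ, V p.1 σ ∂μ) * cov[F, V' p.2; μ]| ≤
      768 * N * Real.sqrt N * (∑ y ∈ ΛF, (max ρ (1 / 2))⁻¹ * δF y) *
          (ΛF.card * (d * ((1 + exp (-(t / 3 / d))) / (1 - exp (-(t / 3 / d)))) ^ d)) *
          (L * L' * (ΛF.card * (d * ((1 + exp (-(t / 3 / d))) / (1 - exp (-(t / 3 / d)))) ^ d)) +
            L' * L₂ * (d * ((1 + exp (-(t / 3 / d))) / (1 - exp (-(t / 3 / d)))) ^ d) +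
            L * L₂' * (d * ((1 + exp (-(t / 3 / d))) / (1 - exp (-(t / 3 / d)))) ^ d)) := by
    intro S
    have hsub : S ⊆ S.image Prod.fst ×ˢ S.image Prod.snd := fun p hp =>
      Finset.mem_product.2 ⟨Finset.mem_image_of_mem _ hp, Finset.mem_image_of_mem _ hp⟩
    refine (Finset.sum_le_sum_of_subset_of_nonneg hsub fun _ _ _ => abs_nonneg _).trans ?_
    rw [Finset.sum_product]
    exact sum_abs_threePoint_le_star hd hγ hD hloc hρ0 hρ1 hwin hμ ht hFm hFdep hMF hδF hVm hVdep hVb hlipV hLs hL hL2s hL2 hV'm hV'dep hV'b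
      hlipV' hL's hL' hL2's hL2' _ _
  exact ⟨summable_of_sum_le (fun _ => abs_nonneg _) hpartial, Real.tsum_le_of_sum_le (fun _ => abs_nonneg _) hpartial⟩

end Star

/-! ### `SU(2)`, `ℤ⁴`: the Wilson point up to `β_W = 1/3` -/

/-- ★ **THE `SU(2)` WILSON POINT ON `ℤ⁴`, EVERY `0 ≤ β_W ≤ 1/3`: FINITE SECOND-ORDER STATIC SUSCEPTIBILITY OF EVERY LIPSCHITZ CYLINDER AGAINST EVERY
TWO DIRECTIONS OF FINITE (SIZE-WEIGHTED) LIPSCHITZ LOAD** (received sum `≤ 399/400` along the segment, star radius `D = 3`): for every DLR `μ` (bare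
coupling `β_W/2`) and directions `V`, `V'` (measurable bounded own-link terms; Lipschitz witnesses of total loads `≤ L, L'` and size-weighted loads
`≤ L₂, L₂'` through every link), `(X, Y) ↦ |u₃(F; V_X; V'_Y)|` is summable over all pairs of finite link sets. -/
theorem su2_wilson_summable_abs_threePoint_upTo_oneThird {βW : ℝ} (h0 : 0 ≤ βW) (h1 : βW ≤ 1 / 3)
    {μ : Measure (LGConfig 4 (SUN 2))} (hμ : μ ∈ ymGibbsMeasures (d := 4) (fundamentalRep (Fin 2)) (2 * (βW / 4)))
    {F : LGConfig 4 (SUN 2) → ℝ} {ΛF : Finset (ZdEdge 4)} {KF : ℝ≥0} (hF : IsLipschitzCylinder (fundamentalRep (Fin 2)) F ΛF KF)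
    {V V' : Potential (ZdEdge 4) (SUN 2)}
    (hVm : ∀ X, Measurable (V X)) (hVdep : ∀ X, DependsOn (V X) (↑X : Set (ZdEdge 4))) (hVb : ∀ X, ∃ C, ∀ U, |V X U| ≤ C)
    {lipV : Finset (ZdEdge 4) → ZdEdge 4 → ℝ} (hlipV : ∀ X, IsLipBound suFrobDist (V X) (lipV X)) {L L₂ : ℝ}
    (hLs : ∀ e, Summable fun X : Finset (ZdEdge 4) => (if e ∈ X then ∑ y ∈ X, lipV X y else 0))
    (hL : ∀ e, ∑' X : Finset (ZdEdge 4), (if e ∈ X then ∑ y ∈ X, lipV X y else 0) ≤ L)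
    (hL2s : ∀ e, Summable fun X : Finset (ZdEdge 4) => (if e ∈ X then X.card * ∑ y ∈ X, lipV X y else 0))
    (hL2 : ∀ e, ∑' X : Finset (ZdEdge 4), (if e ∈ X then X.card * ∑ y ∈ X, lipV X y else 0) ≤ L₂)
    (hV'm : ∀ X, Measurable (V' X)) (hV'dep : ∀ X, DependsOn (V' X) (↑X : Set (ZdEdge 4))) (hV'b : ∀ X, ∃ C, ∀ U, |V' X U| ≤ C)
    {lipV' : Finset (ZdEdge 4) → ZdEdge 4 → ℝ} (hlipV' : ∀ X, IsLipBound suFrobDist (V' X) (lipV' X)) {L' L₂' : ℝ}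
    (hL's : ∀ e, Summable fun X : Finset (ZdEdge 4) => (if e ∈ X then ∑ y ∈ X, lipV' X y else 0))
    (hL' : ∀ e, ∑' X : Finset (ZdEdge 4), (if e ∈ X then ∑ y ∈ X, lipV' X y else 0) ≤ L')
    (hL2's : ∀ e, Summable fun X : Finset (ZdEdge 4) => (if e ∈ X then X.card * ∑ y ∈ X, lipV' X y else 0))
    (hL2' : ∀ e, ∑' X : Finset (ZdEdge 4), (if e ∈ X then X.card * ∑ y ∈ X, lipV' X y else 0) ≤ L₂') :
    Summable (fun p : Finset (ZdEdge 4) × Finset (ZdEdge 4) =>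
      |cov[fun σ => F σ * V p.1 σ, V' p.2; μ] - (∫ σ, F σ ∂μ) * cov[V p.1, V' p.2; μ] - (∫ σ, V p.1 σ ∂μ) * cov[F, V' p.2; μ]|) := by
  classical
  haveI : SecondCountableTopology (Matrix (Fin 2) (Fin 2) ℂ) := inferInstanceAs (SecondCountableTopology (Fin 2 → Fin 2 → ℂ))
  haveI : SecondCountableTopology (SUN 2) := Topology.IsEmbedding.subtypeVal.secondCountableTopology
  -- the zero member of `MemBallZdG (3/125) (3/250) 0` and its star window bound at received sum `≤ 399/400`
  have hmem : MemBallZdG (N := 2) (d := 4) (3 / 125) (3 / 250) 0 0 (fun _ => (∅ : Finset (Finset (ZdEdge 4)))) :=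
    memBallZdG_zero (by norm_num) (by norm_num) 0
  have habs : |((2 : ℕ) : ℝ) * (βW / 4)| / ((2 : ℕ) : ℝ) = βW / 4 := by
    rw [abs_of_nonneg (by positivity)]; push_cast; ring
  have hR : |((2 : ℕ) : ℝ) * (βW / 4)| / ((2 : ℕ) : ℝ) * (2 * (((4 : ℕ) : ℝ) - 1)) ≤ 3 * βW / 2 := by
    rw [habs]; push_cast; linarith
  have hc' : (1 : ℝ) * Real.exp (3 / 125) * (1 + 2 * Real.sqrt ((2 : ℕ) : ℝ) * (3 / 250)) *
      (|((2 : ℕ) : ℝ) * (βW / 4)| / ((2 : ℕ) : ℝ)) ≤ 17651 / 200000 := by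
    have h2 : Real.sqrt ((2 : ℕ) : ℝ) = Real.sqrt 2 := by norm_num
    rw [h2, one_mul, habs]
    have hb : 0 ≤ βW / 4 := by positivity
    calc Real.exp (3 / 125) * (1 + 2 * Real.sqrt 2 * (3 / 250)) * (βW / 4)
        ≤ 1024291 / 1000000 * (1 + 2 * 1.41422 * (3 / 250)) * ((1 / 3) / 4) := by
          gcongr
          · exact exp_le_3_125_star
          · exact sqrt_two_le
      _ ≤ 17651 / 200000 := by norm_num
  have hlam' : Real.sqrt ((2 : ℕ) : ℝ) * (3 / 250 : ℝ) ≤ 16971 / 1000000 := by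
    have h2 : Real.sqrt ((2 : ℕ) : ℝ) = Real.sqrt 2 := by norm_num
    rw [h2]; nlinarith [sqrt_two_le, Real.sqrt_nonneg 2]
  have hwin := (starWindowBoundZdR_of_memBallZdG (d := 4) (N := 2) (by norm_num) (by norm_num) zero_le_one hR
    (su2_quarterModulus (h1.trans (by norm_num))) (by norm_num) hc' hlam' (θ := 6 * (17651 / 200000) + 16971 / 1000000)
    (by push_cast; ring) (by norm_num) (by unfold doorPoly; norm_num) (Kn := 20)
    (ρ := gaugeR 4 (17651 / 200000) + (16971 / 1000000 + (6 * (17651 / 200000) + 16971 / 1000000) ^ 20 * (4 * 4 * (16971 / 1000000))) /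
      (1 - (6 * (17651 / 200000) + 16971 / 1000000))) (by push_cast; ring) hmem).mono_rho
    (show _ ≤ (399 / 400 : ℝ) by unfold gaugeR Delta; norm_num)
  have hμ' : μ ∈ perturbedGibbsMeasures (d := 4) (fundamentalRep (Fin 2)) ((2 : ℕ) * (βW / 4))
      (0 : Potential (ZdEdge 4) (SUN 2)) (fun _ => ∅) := by
    rw [perturbedGibbsMeasures_zero]; exact_mod_cast hμ
  have hA : ∀ a b : SUN 2, dist (suEntries a) (suEntries b) ≤ 1 * suFrobDist a b :=
    fun a b => by rw [one_mul]; exact dist_suEntries_le_suFrobDist a b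
  -- the specification-level data of the zero member
  have hW : (0 : Potential (ZdEdge 4) (SUN 2)).IsAdapted := fun X => ⟨hmem.dependsOn X, (hmem.continuous X).measurable⟩
  have hWb : ∀ X, ∃ C, ∀ U, |(0 : Potential (ZdEdge 4) (SUN 2)) X U| ≤ C := fun X => exists_bound_of_continuous (hmem.continuous X)
  have hγ : IsSpecification (perturbedYM (d := 4) (fundamentalRep (Fin 2)) ((2 : ℕ) * (βW / 4)) (0 : Potential (ZdEdge 4) (SUN 2)) (fun _ => ∅)) :=
    isSpecification_perturbedYM _ (continuous_fundamentalRep (Fin 2)) _ hW hWb hmem.supportedBy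
  have hμG : IsGibbsMeasure (perturbedYM (d := 4) (fundamentalRep (Fin 2)) ((2 : ℕ) * (βW / 4)) (0 : Potential (ZdEdge 4) (SUN 2)) (fun _ => ∅)) μ :=
    hμ'
  have hloc : ∀ (c : ZdEdge 4) (ζ ζ' : LGConfig 4 (SUN 2)), (∀ v ∈ starNbhdZdR (max 0 1 + 2) c.1, ζ v = ζ' v) →
      ∀ (g : LGConfig 4 (SUN 2) → ℝ), Measurable g → (∃ B, ∀ σ, |g σ| ≤ B) →
        DependsOn g (starWinZd c : Set (ZdEdge 4)) →
        ∫ σ, g σ ∂(perturbedYM (d := 4) (fundamentalRep (Fin 2)) ((2 : ℕ) * (βW / 4)) (0 : Potential (ZdEdge 4) (SUN 2)) (fun _ => ∅)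
          (starWinZd c) ζ) =
          ∫ σ, g σ ∂(perturbedYM (d := 4) (fundamentalRep (Fin 2)) ((2 : ℕ) * (βW / 4)) (0 : Potential (ZdEdge 4) (SUN 2)) (fun _ => ∅)
          (starWinZd c) ζ') :=
    fun c ζ ζ' hζ g hgm _ hgdep => perturbed_star_hloc _ (continuous_fundamentalRep (Fin 2)) _
      (fun X => (hmem.continuous X).measurable) hmem.dependsOn hmem.supportedBy hmem.range (show 0 + 2 ≤ max 0 1 + 2 by norm_num) c ζ ζ' hζ g
      hgm hgdep
  exact (summable_abs_threePoint_direction_star (N := 2) (d := 4) (by norm_num) hγ (by norm_num) hloc (by norm_num) (by norm_num) hwin hμG rfl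
    hF.measurable hF.dependsOn hF.abs_le (hF.isLipBound zero_le_one hA) hVm hVdep hVb hlipV hLs hL hL2s hL2 hV'm hV'dep hV'b hlipV' hL's hL'
    hL2's hL2').1

end Summit.Ventures.YMGap.RobustBall

end
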